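import Literature.Claims.NS.Seo2025
import Literature.Analysis.FluidPDE.ClaySettingParasiticDrift
import HarnessLib

/-!
# C163 `Seo2025` — second-refuter records object (ns-claims-refuter-5 g4): the Clay-link posit
`Thm31_energyBarrier` is false at every viscosity

Cell `ns-claims` (D-0090), claim C163, skeleton `Literature/Claims/NS/Seo2025.lean` (p532634,
sha16 `89d75ba4f9aea972`). OFF the printed proof path of Thm 4.1 (the head of record is
`Literature.Claims.NS.Seo2025.Thm41`, refuted by `…Theorems.Seo2025.not_Thm41`, refuter-2 g7); this file
concerns only the typist's Clay link `clay_of_claimed : ClaimedTheorem → (∀ ν, Thm31_energyBarrier ν) →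
clayR3.Regularity`, whose second hypothesis — Thm 3.1 + Figure 1 p.2 typed at the grain «EVERY global
smooth solution of (10) from an `L²` datum has bounded energy» — is unsatisfiable as typed: the
Clay-setting parasitic drift from the zero datum (Koch–Nadirashvili–Seregin–Šverák; tree
`exists_parasitic_solution_zero_datum`) is a global smooth solution of (10) from `u₀ = 0 ∈ L²(ℝ³)` with
unbounded energy. Records/RETYPE matter (repair: carry the energy bound (7) inside the `∃ (u, p)` of the
claimed statement, printed support Thm 3.1 (5) p.2); VERDICT record (d′) (refuter-2 g7 13:41:48Z).

WHAT THIS IS NOT: not a claim about NS regularity or blow-up; not a claim about any author beyond the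
typed locator.
-/

open MeasureTheory

noncomputable section

set_option linter.dupNamespace false

namespace Summit.NavierStokesRegularity.NavierStokesRegularity.Theorems.Seo2025Second

open Literature.Analysis.FluidPDE Literature.Claims.NS.Seo2025

/-- The zero field is weakly divergence free (the integrand vanishes). [folklore] -/
theorem isWeaklyDivFree_zero : IsWeaklyDivFree (0 : E3 → E3) := fun θ _ => by simp

/-- **The Clay-link posit `Thm31_energyBarrier ν` is false at every `ν`**: the Clay-setting parasitic
drift from the zero datum is a global smooth solution of (10) from `u₀ = 0 ∈ L²(ℝ³)` with unbounded
energy (tree `exists_parasitic_solution_zero_datum`).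
[cite: Seo2025, Thm 3.1 p.2 l.3–11; Figure 1 p.2 l.25–29] -/
theorem not_Thm31_energyBarrier (ν : ℝ) : ¬ Thm31_energyBarrier ν := by
  intro h
  obtain ⟨u, p, hns, hsu, hsp, -, hE⟩ := exists_parasitic_solution_zero_datum ν
  exact hE (h 0 MemLp.zero isWeaklyDivFree_zero u p hsu hsp hns)

/-- Type-exactness guard against the landed skeleton decl. -/
example (ν : ℝ) : ¬ Literature.Claims.NS.Seo2025.Thm31_energyBarrier ν := not_Thm31_energyBarrier ν

/-- Consequence for the link as typed: its hypotheses are jointly unsatisfiable, so it yields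
`clayR3.Regularity` from nothing that could hold. [cite: Seo2025, (10) p.4; Thm 3.1 p.2] -/
example (_h : Literature.Claims.NS.Seo2025.ClaimedTheorem)
    (hE : ∀ ν, Literature.Claims.NS.Seo2025.Thm31_energyBarrier ν) : False :=
  not_Thm31_energyBarrier 1 (hE 1)

end Summit.NavierStokesRegularity.NavierStokesRegularity.Theorems.Seo2025Second

end

-- WHAT THIS IS NOT: not a claim about NS regularity or blow-up; not a claim about any author beyond the typed locator.
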